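import Literature.NumberTheory.LFunctions.KroneckerCharacter
import Literature.NumberTheory.LFunctions.KroneckerCharacterNeOne

/-!
# The Kronecker character `χ_D` of a fundamental discriminant is PRIMITIVE (conductor `|D|`)

Topic `Literature/NumberTheory/LFunctions` (sub-namespace `KroneckerCharacter`; companion of `KroneckerCharacter.lean`,
p509794, which constructs `kroneckerChar D : DirichletCharacter ℂ D.natAbs` and proves its Kronecker values, and of
`KroneckerCharacterNeOne.lean`). Typed for the cell landau-siegel (LS RESCUE, D-0124 (3) bed; typer ls-rescue-typ-1):
with `isQuadratic_kroneckerChar` this makes `χ_D` literally «a real primitive character to the modulus `|D|`», the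
object the summit-side statements (`Zhang2022.Skeleton.LOneLowerBound`, `AssumptionA`, …) quantify over, so that bed
rows at explicit moduli instantiate those statements exactly. No claim about Landau–Siegel zeros.

## What is here (all PROVED)

* `isPrimitive_of_forall_prime` — a primitivity criterion for a Dirichlet character `χ` mod `n ≠ 0`: if for every
  prime `p ∣ n` some `a` prime to `n` with `a ≡ 1 (mod n/p)` has `χ(a) ≠ 1`, then `χ` is primitive (the conductor
  divides `n`; were it proper, `χ` would factor through some `n/p`, Mathlib `mem_conductorSet_iff_conductor_dvd` +
  `factorsThrough_iff_ker_unitsMap`, and be `1` on the kernel of `(ℤ/n)ˣ → (ℤ/(n/p))ˣ`).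
* witnesses: `exists_jacobiSym_eq_neg_one` (a non-residue at an odd prime, `FiniteField.exists_nonsquare`),
  `exists_witness_odd_prime` (CRT: `a ≡ 1 (mod n/p)`, `(a/p) = −1`, `a` prime to `n`, for `p ∥ n`),
  `coprime_div_of_squarefree`, `changeLevel_apply_natCast`, `jacobiSym_eq_one_of_modEq_one`.
* `isPrimitive_kroneckerChar_of_odd` (`D ≡ 1 (mod 4)` square-free), `_of_four` (`D = 4m`, `m ≡ 3 (4)`, i.e.
  `D ≡ 12 (mod 16)`, `D/4` square-free; the prime `2` is witnessed by `a = 1 + |D|/2 ≡ 3 (mod 4)`), `_of_eight`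
  (`D ≡ 8 (mod 16)`, `a = 1 + |D|/2 ≡ 5 (mod 8)` where `χ₈(5) = χ₈'(5) = −1`), and
* **`isPrimitive_kroneckerChar : IsFundamentalDiscriminant D → (kroneckerChar D).IsPrimitive`.**
* Rev 2 (append): `three_le_natAbs_of_isFundamentalDiscriminant` (`|D| ≥ 3`) and **`kroneckerChar_ne_one`** —
  `χ_D ≠ 1` for EVERY fundamental `D` (conductor `|D| ≠ 1`), hence `LFunction_one_pos` (`L(1,χ_D)` real `> 0`)
  without the inert-prime witness of `KroneckerCharacterNeOne`.

## References

* H. L. Montgomery, R. C. Vaughan, *Multiplicative Number Theory I* (2007), §9.1 (primitive characters, conductor),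
  §9.3 (the quadratic character of a fundamental discriminant is primitive mod `|d|`). [cite: MontgomeryVaughan2007, §9.3]
-/

noncomputable section

open Complex

namespace Literature.NumberTheory.LFunctions.KroneckerCharacter

open Literature.Barriers.RiemannHypothesis (IsFundamentalDiscriminant)

/-- **A primitivity criterion.** A Dirichlet character `χ` mod `n ≠ 0` is primitive as soon as, for every prime
`p ∣ n`, some `a` coprime to `n` with `a ≡ 1 (mod n/p)` has `χ(a) ≠ 1`: then `χ` factors through no `n/p`, and the
conductor, a divisor of `n`, cannot be proper. [cite: MontgomeryVaughan2007, §9.1] -/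
theorem isPrimitive_of_forall_prime {n : ℕ} [NeZero n] (χ : DirichletCharacter ℂ n)
    (h : ∀ p : ℕ, p.Prime → p ∣ n → ∃ a : ℕ, a.Coprime n ∧ (a : ZMod (n / p)) = 1 ∧ χ (a : ZMod n) ≠ 1) :
    χ.IsPrimitive := by
  rw [DirichletCharacter.isPrimitive_def]
  by_contra hc
  set c := χ.conductor with hc_def
  have hcn : c ∣ n := χ.conductor_dvd_level
  obtain ⟨k, hk⟩ := hcn
  have hk1 : k ≠ 1 := by
    rintro rfl; exact hc (by rw [hk, mul_one])
  have hk0 : k ≠ 0 := by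
    rintro rfl; exact (NeZero.ne n) (by rw [hk, mul_zero])
  -- a prime factor `p` of `k = n / c`
  obtain ⟨p, hp, hpk⟩ := Nat.exists_prime_and_dvd hk1
  obtain ⟨j, hj⟩ := hpk
  have hpn : p ∣ n := ⟨c * j, by rw [hk, hj]; ring⟩
  have hnp : n / p = c * j := by
    rw [hk, hj, show c * (p * j) = p * (c * j) by ring, Nat.mul_div_cancel_left _ hp.pos]
  have hdvd : n / p ∣ n := Nat.div_dvd_of_dvd hpn
  -- `χ` factors through `n / p` since the conductor divides it
  have hfac : χ.FactorsThrough (n / p) :=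
    (χ.mem_conductorSet_iff_conductor_dvd hdvd).mpr ⟨j, hnp⟩
  rw [DirichletCharacter.factorsThrough_iff_ker_unitsMap (χ := χ) hdvd] at hfac
  obtain ⟨a, hcop, ha1, hχa⟩ := h p hp hpn
  -- the unit `a` lies in the kernel of the reduction `(ZMod n)ˣ → (ZMod (n/p))ˣ`
  have hmem : ZMod.unitOfCoprime a hcop ∈ (ZMod.unitsMap hdvd).ker := by
    rw [MonoidHom.mem_ker, Units.ext_iff, ZMod.unitsMap_val, ZMod.coe_unitOfCoprime, ZMod.cast_natCast hdvd,
      ha1, Units.val_one]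
  have := hfac hmem
  rw [MonoidHom.mem_ker, Units.ext_iff, MulChar.coe_toUnitHom, ZMod.coe_unitOfCoprime, Units.val_one] at this
  exact hχa this


/-! ## Witnesses: an element `≡ 1 (mod n/p)` on which the character is `−1` -/

/-- `a ≡ 1 (mod d)` forces `(a/d) = 1`. [cite: MontgomeryVaughan2007, §9.3] -/
theorem jacobiSym_eq_one_of_modEq_one {a d : ℕ} (h : a ≡ 1 [MOD d]) : jacobiSym (a : ℤ) d = 1 := by
  rw [jacobiSym.mod_left' (a₂ := 1) (by exact_mod_cast h), jacobiSym.one_left]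

/-- A quadratic non-residue witness at an odd prime. [cite: MontgomeryVaughan2007, §9.3] -/
theorem exists_jacobiSym_eq_neg_one {p : ℕ} (hp : p.Prime) (hp2 : p ≠ 2) :
    ∃ b : ℕ, b ≠ 0 ∧ b < p ∧ jacobiSym (b : ℤ) p = -1 := by
  haveI : Fact p.Prime := ⟨hp⟩
  obtain ⟨x, hx⟩ := FiniteField.exists_nonsquare (F := ZMod p) (by rwa [ZMod.ringChar_zmod_n p])
  refine ⟨x.val, ?_, ZMod.val_lt x, ?_⟩
  · intro h0
    apply hx
    rw [ZMod.val_eq_zero] at h0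
    exact h0 ▸ IsSquare.zero
  · rw [← jacobiSym.legendreSym.to_jacobiSym, legendreSym.eq_neg_one_iff]
    simpa only [Int.cast_natCast, ZMod.natCast_zmod_val] using hx

/-- **The CRT witness at an odd prime `p ∥ n`**: some `a` coprime to `n` with `a ≡ 1 (mod n/p)` and `(a/p) = −1`.
[cite: MontgomeryVaughan2007, §9.3] -/
theorem exists_witness_odd_prime {n p : ℕ} (hp : p.Prime) (hp2 : p ≠ 2) (hpn : p ∣ n)
    (hcop : (n / p).Coprime p) :
    ∃ a : ℕ, a.Coprime n ∧ a ≡ 1 [MOD n / p] ∧ jacobiSym (a : ℤ) p = -1 := by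
  obtain ⟨b, hb0, hbp, hb⟩ := exists_jacobiSym_eq_neg_one hp hp2
  obtain ⟨a, ha1, hab⟩ := Nat.chineseRemainder hcop 1 b
  refine ⟨a, ?_, ha1, ?_⟩
  · have h1 : a.Coprime (n / p) := by
      rw [Nat.Coprime, ha1.gcd_eq]; exact Nat.gcd_one_left _
    have h2 : a.Coprime p := by
      rw [Nat.Coprime, hab.gcd_eq]; exact (Nat.coprime_of_lt_prime hb0 hbp hp).symm
    have := Nat.Coprime.mul_right h1 h2
    rwa [Nat.div_mul_cancel hpn] at this
  · rw [jacobiSym.mod_left' (a₂ := (b : ℤ)) (by exact_mod_cast hab), hb]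

/-- For a square-free `n` and a prime `p ∣ n`, `n/p` is prime to `p`. [cite: MontgomeryVaughan2007, §9.3] -/
theorem coprime_div_of_squarefree {n p : ℕ} (hn : Squarefree n) (hp : p.Prime) (hpn : p ∣ n) :
    (n / p).Coprime p := by
  rw [Nat.Coprime, Nat.gcd_comm, ← Nat.Coprime, hp.coprime_iff_not_dvd]
  intro h
  obtain ⟨t, ht⟩ := h
  have : p * p ∣ n := ⟨t, by rw [← Nat.div_mul_cancel hpn, ht]; ring⟩
  exact (Nat.squarefree_iff_prime_squarefree.mp hn) p hp this

/-- The value of a lifted character at a natural number coprime to the big level. [cite: MontgomeryVaughan2007, §9.3] -/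
theorem changeLevel_apply_natCast {d n : ℕ} (hd : d ∣ n) (ψ : DirichletCharacter ℂ d) {a : ℕ} (ha : a.Coprime n) :
    DirichletCharacter.changeLevel hd ψ (a : ZMod n) = ψ (a : ZMod d) := by
  have := DirichletCharacter.changeLevel_eq_cast_of_dvd' ψ hd (a := (a : ℤ)) (Nat.isCoprime_iff_coprime.mpr ha)
  simpa only [Int.cast_natCast] using this

/-- `a ≡ 1 (mod n/p)` and `d ∣ n/p` give `a ≡ 1 (mod d)`, hence `(a : ZMod d) = 1`. [cite: MontgomeryVaughan2007, §9.3] -/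
theorem natCast_eq_one_of_modEq {a m d : ℕ} (h : a ≡ 1 [MOD m]) (hd : d ∣ m) : (a : ZMod d) = 1 := by
  have := (ZMod.natCast_eq_natCast_iff _ _ _).mpr (h.of_dvd hd)
  rwa [Nat.cast_one] at this

/-! ## Primitivity in the three fundamental shapes -/

/-- **Odd shape.** For `D ≡ 1 (mod 4)` square-free, `χ_D = (·/|D|)` is primitive of conductor `|D|`.
[cite: MontgomeryVaughan2007, §9.3] -/
theorem isPrimitive_kroneckerChar_of_odd {D : ℤ} (h : D % 4 = 1) (hsq : Squarefree D) [NeZero D.natAbs] :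
    (kroneckerChar D).IsPrimitive := by
  rw [kroneckerChar_of_odd h]
  apply isPrimitive_of_forall_prime
  intro p hp hpn
  have hodd : D.natAbs % 2 = 1 := by omega
  have hp2 : p ≠ 2 := by
    rintro rfl; omega
  have hsqn : Squarefree D.natAbs := Int.squarefree_natAbs.mpr hsq
  obtain ⟨a, hcop, ha1, hap⟩ := exists_witness_odd_prime hp hp2 hpn (coprime_div_of_squarefree hsqn hp hpn)
  refine ⟨a, hcop, natCast_eq_one_of_modEq ha1 (dvd_refl _), ?_⟩
  haveI : NeZero (D.natAbs / p) := ⟨fun h0 => (NeZero.ne D.natAbs) (Nat.eq_zero_of_dvd_of_div_eq_zero hpn h0)⟩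
  haveI : NeZero p := ⟨hp.ne_zero⟩
  rw [jacobiChar_natCast]
  conv => lhs; rw [← Nat.div_mul_cancel hpn, jacobiSym.mul_right, jacobiSym_eq_one_of_modEq_one ha1, one_mul, hap]
  norm_num

/-- `|D|/4` is odd and `|D| = 4·(|D|/4)` when `D ≡ 12 (mod 16)`. [cite: MontgomeryVaughan2007, §9.3] -/
private theorem shape_four {D : ℤ} (h : D % 16 = 12) :
    D.natAbs = 4 * (D.natAbs / 4) ∧ (D.natAbs / 4) % 2 = 1 := by
  have h4 : 4 ∣ D.natAbs := by
    rw [← Int.natCast_dvd]; exact Int.dvd_of_emod_eq_zero (by omega)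
  have hn : D.natAbs = 4 * (D.natAbs / 4) := (Nat.mul_div_cancel' h4).symm
  refine ⟨hn, ?_⟩
  rcases Int.natAbs_eq D with hD | hD <;> omega

/-- `|D|/8` is odd and `|D| = 8·(|D|/8)` when `D ≡ 8 (mod 16)`. [cite: MontgomeryVaughan2007, §9.3] -/
private theorem shape_eight {D : ℤ} (h : D % 16 = 8) :
    D.natAbs = 8 * (D.natAbs / 8) ∧ (D.natAbs / 8) % 2 = 1 := by
  have h8 : 8 ∣ D.natAbs := by
    rw [← Int.natCast_dvd]; exact Int.dvd_of_emod_eq_zero (by omega)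
  have hn : D.natAbs = 8 * (D.natAbs / 8) := (Nat.mul_div_cancel' h8).symm
  refine ⟨hn, ?_⟩
  rcases Int.natAbs_eq D with hD | hD <;> omega

/-- Square-freeness of the odd part `|D|/4` resp. of `|D|/8` from `Squarefree (D/4)`. [cite: MontgomeryVaughan2007, §9.3] -/
private theorem squarefree_natAbs_div_four {D : ℤ} (h4 : (4 : ℤ) ∣ D) (hsq : Squarefree (D / 4)) :
    Squarefree (D.natAbs / 4) := by
  have : (D / 4).natAbs = D.natAbs / 4 := by rw [Int.natAbs_ediv_of_dvd h4]; rfl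
  rw [← this]
  exact Int.squarefree_natAbs.mpr hsq

/-- The odd-prime step common to the even shapes: for `n = e·q` (`e ∈ {4, 8}`, `q` odd square-free), an odd prime
`p ∣ n` divides `q`, and the CRT witness `a ≡ 1 (mod n/p)` is `≡ 1 (mod e)`, `≡ 1 (mod q/p)` and has `(a/q) = −1`.
[cite: MontgomeryVaughan2007, §9.3] -/
private theorem witness_even_shape {n e q p : ℕ} (hn : n = e * q) (he : e = 4 ∨ e = 8) (hq : q % 2 = 1)
    (hsq : Squarefree q) (hp : p.Prime) (hp2 : p ≠ 2) (hpn : p ∣ n) :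
    ∃ a : ℕ, a.Coprime n ∧ (a : ZMod (n / p)) = 1 ∧ (a : ZMod e) = 1 ∧ jacobiSym (a : ℤ) q = -1 := by
  have hpe : ¬ p ∣ e := by
    rcases he with rfl | rfl
    · rw [show (4 : ℕ) = 2 ^ 2 by norm_num]
      exact fun hd => hp2 ((Nat.prime_dvd_prime_iff_eq hp Nat.prime_two).mp (hp.dvd_of_dvd_pow hd))
    · rw [show (8 : ℕ) = 2 ^ 3 by norm_num]
      exact fun hd => hp2 ((Nat.prime_dvd_prime_iff_eq hp Nat.prime_two).mp (hp.dvd_of_dvd_pow hd))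
  have hpq : p ∣ q := by
    rw [hn] at hpn
    exact (Nat.Prime.dvd_mul hp).mp hpn |>.resolve_left hpe
  have he0 : e ≠ 0 := by rcases he with rfl | rfl <;> norm_num
  -- `n / p = e * (q / p)` is prime to `p`
  have hnp : n / p = e * (q / p) := by
    rw [hn, Nat.mul_div_assoc _ hpq]
  have hcop : (n / p).Coprime p := by
    rw [hnp]
    exact Nat.Coprime.mul_left ((Nat.Prime.coprime_iff_not_dvd hp).mpr hpe).symm
      (coprime_div_of_squarefree hsq hp hpq)
  obtain ⟨a, hcopa, ha1, hap⟩ := exists_witness_odd_prime hp hp2 hpn hcop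
  refine ⟨a, hcopa, natCast_eq_one_of_modEq ha1 (dvd_refl _), natCast_eq_one_of_modEq ha1 ⟨q / p, hnp⟩, ?_⟩
  haveI : NeZero (q / p) := ⟨fun h0 => by
    have := Nat.eq_zero_of_dvd_of_div_eq_zero hpq h0; omega⟩
  haveI : NeZero p := ⟨hp.ne_zero⟩
  have hqp : a ≡ 1 [MOD q / p] := ha1.of_dvd ⟨e, by rw [hnp]; ring⟩
  conv => lhs; rw [← Nat.div_mul_cancel hpq, jacobiSym.mul_right, jacobiSym_eq_one_of_modEq_one hqp, one_mul]
  exact hap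

/-- The `p = 2` step common to the even shapes: `a = 1 + n/2` is prime to `n = e·q`, `≡ 1 (mod n/2)`, `≡ 1 (mod q)`.
[cite: MontgomeryVaughan2007, §9.3] -/
private theorem witness_two {n e q : ℕ} (hn : n = e * q) (he : e = 4 ∨ e = 8) (hq : q % 2 = 1) :
    (1 + n / 2).Coprime n ∧ ((1 + n / 2 : ℕ) : ZMod (n / 2)) = 1 ∧ jacobiSym ((1 + n / 2 : ℕ) : ℤ) q = 1 ∧
      (1 + n / 2) % e = 1 + e / 2 := by
  have h2n : n / 2 = (e / 2) * q := by rcases he with rfl | rfl <;> omega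
  have hmodq : 1 + n / 2 ≡ 1 [MOD q] := by rw [Nat.ModEq, h2n, Nat.add_mul_mod_self_right]
  have hodd2 : (1 + n / 2).Coprime 2 := by
    have hodd : (1 + n / 2) % 2 = 1 := by rw [h2n]; rcases he with rfl | rfl <;> omega
    exact (Nat.odd_iff.mpr hodd).coprime_two_right
  have hce : (1 + n / 2).Coprime e := by
    rcases he with rfl | rfl
    · have := Nat.Coprime.pow_right 2 hodd2; rwa [show (2 : ℕ) ^ 2 = 4 by norm_num] at this
    · have := Nat.Coprime.pow_right 3 hodd2; rwa [show (2 : ℕ) ^ 3 = 8 by norm_num] at this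
  have hcq : (1 + n / 2).Coprime q := by rw [Nat.Coprime, hmodq.gcd_eq]; exact Nat.gcd_one_left _
  refine ⟨?_, natCast_eq_one_of_modEq Nat.add_modEq_right (dvd_refl _), jacobiSym_eq_one_of_modEq_one hmodq, ?_⟩
  · have key := Nat.Coprime.mul_right hce hcq; rwa [← hn] at key
  · rw [h2n]; rcases he with rfl | rfl <;> omega

/-- **Shape `D = 4m`, `m ≡ 3 (mod 4)` square-free** (`D ≡ 12 (mod 16)`): `χ_D` is primitive of conductor `|D|`.
[cite: MontgomeryVaughan2007, §9.3] -/
theorem isPrimitive_kroneckerChar_of_four {D : ℤ} (h : D % 16 = 12) (hsq : Squarefree (D / 4))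
    [NeZero D.natAbs] : (kroneckerChar D).IsPrimitive := by
  obtain ⟨hn, hq⟩ := shape_four h
  have hsq' : Squarefree (D.natAbs / 4) := squarefree_natAbs_div_four (Int.dvd_of_emod_eq_zero (by omega)) hsq
  rw [kroneckerChar_of_four h]
  haveI : NeZero (D.natAbs / 4) := ⟨by omega⟩
  apply isPrimitive_of_forall_prime
  intro p hp hpn
  by_cases hp2 : p = 2
  · subst hp2
    obtain ⟨hcop, h1, hJ, hmod⟩ := witness_two hn (Or.inl rfl) hq
    refine ⟨1 + D.natAbs / 2, hcop, h1, ?_⟩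
    have h3 : (1 + D.natAbs / 2) % 4 = 3 := by norm_num at hmod; omega
    rw [MulChar.mul_apply, changeLevel_apply_natCast _ _ hcop, changeLevel_apply_natCast _ _ hcop, chiNeg4,
      MulChar.ringHomComp_apply, jacobiChar_natCast, hJ, ZMod.χ₄_nat_three_mod_four h3]
    norm_num
  · obtain ⟨a, hcop, h1, he, hJ⟩ := witness_even_shape hn (Or.inl rfl) hq hsq' hp hp2 hpn
    refine ⟨a, hcop, h1, ?_⟩
    rw [MulChar.mul_apply, changeLevel_apply_natCast _ _ hcop, changeLevel_apply_natCast _ _ hcop, chiNeg4,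
      MulChar.ringHomComp_apply, jacobiChar_natCast, hJ, he, MulChar.map_one]
    norm_num

/-- **Shape `D = 8m″`, `m″` odd square-free** (`D ≡ 8 (mod 16)`): `χ_D` is primitive of conductor `|D|`.
[cite: MontgomeryVaughan2007, §9.3] -/
theorem isPrimitive_kroneckerChar_of_eight {D : ℤ} (h : D % 16 = 8) (hsq : Squarefree (D / 4))
    [NeZero D.natAbs] : (kroneckerChar D).IsPrimitive := by
  obtain ⟨hn, hq⟩ := shape_eight h
  have hsq' : Squarefree (D.natAbs / 8) := by
    have h4 := squarefree_natAbs_div_four (D := D) (Int.dvd_of_emod_eq_zero (by omega)) hsq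
    have : D.natAbs / 4 = 2 * (D.natAbs / 8) := by omega
    rw [this] at h4
    exact Squarefree.of_mul_right h4
  rw [kroneckerChar_of_eight h]
  haveI : NeZero (D.natAbs / 8) := ⟨by omega⟩
  apply isPrimitive_of_forall_prime
  intro p hp hpn
  by_cases hp2 : p = 2
  · subst hp2
    obtain ⟨hcop, h1, hJ, hmod⟩ := witness_two hn (Or.inr rfl) hq
    refine ⟨1 + D.natAbs / 2, hcop, h1, ?_⟩
    have h2' : (1 + D.natAbs / 2) % 2 ≠ 0 := by norm_num at hmod; omega
    have h17 : ¬ ((1 + D.natAbs / 2) % 8 = 1 ∨ (1 + D.natAbs / 2) % 8 = 7) := by norm_num at hmod; omega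
    have h13 : ¬ ((1 + D.natAbs / 2) % 8 = 1 ∨ (1 + D.natAbs / 2) % 8 = 3) := by norm_num at hmod; omega
    rw [MulChar.mul_apply, changeLevel_apply_natCast _ _ hcop, changeLevel_apply_natCast _ _ hcop,
      jacobiChar_natCast, hJ]
    split_ifs
    · rw [chi8, MulChar.ringHomComp_apply, ZMod.χ₈_nat_eq_if_mod_eight, if_neg h2', if_neg h17]
      norm_num
    · rw [chiNeg8, MulChar.ringHomComp_apply, ZMod.χ₈'_nat_eq_if_mod_eight, if_neg h2', if_neg h13]
      norm_num
  · obtain ⟨a, hcop, h1, he, hJ⟩ := witness_even_shape hn (Or.inr rfl) hq hsq' hp hp2 hpn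
    refine ⟨a, hcop, h1, ?_⟩
    rw [MulChar.mul_apply, changeLevel_apply_natCast _ _ hcop, changeLevel_apply_natCast _ _ hcop,
      jacobiChar_natCast, hJ]
    split_ifs
    · rw [chi8, MulChar.ringHomComp_apply, he, MulChar.map_one]; norm_num
    · rw [chiNeg8, MulChar.ringHomComp_apply, he, MulChar.map_one]; norm_num

/-- **The Kronecker character of a fundamental discriminant is PRIMITIVE of conductor `|D|`** — so `χ_D` is exactly
an object the summit-side statements quantify over («real primitive character to the modulus `|D|`»: together with
`isQuadratic_kroneckerChar`). [cite: MontgomeryVaughan2007, §9.3] -/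
theorem isPrimitive_kroneckerChar {D : ℤ} (hD : IsFundamentalDiscriminant D) [NeZero D.natAbs] :
    (kroneckerChar D).IsPrimitive := by
  rcases hD with ⟨h1, hsq, -⟩ | ⟨h4, h23, hsq⟩
  · exact isPrimitive_kroneckerChar_of_odd h1 hsq
  · rcases h23 with h3 | h3
    · obtain ⟨k, hk⟩ := h4
      have : D % 16 = 8 := by subst hk; omega
      exact isPrimitive_kroneckerChar_of_eight this hsq
    · obtain ⟨k, hk⟩ := h4
      have : D % 16 = 12 := by subst hk; omega
      exact isPrimitive_kroneckerChar_of_four this hsq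

/-! ## Rev 2 (append): non-triviality for every fundamental discriminant -/

/-- A fundamental discriminant has `|D| ≥ 3` (`D ∈ {−3, −4, 5, −7, ±8, …}`). [cite: MontgomeryVaughan2007, §9.3] -/
theorem three_le_natAbs_of_isFundamentalDiscriminant {D : ℤ} (hD : IsFundamentalDiscriminant D) : 3 ≤ D.natAbs := by
  rcases hD with ⟨h1, hsq, hne⟩ | ⟨h4, h23, hsq⟩
  · -- odd: `D ≡ 1 (mod 4)`, `D ≠ 1`, and `D ≠ -3 + 4k` small cases: `D ∉ {0, ±1, ±2}`; `D = -3` gives `3`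
    have h0 : D ≠ 0 := fun h => by subst h; omega
    rcases Int.natAbs_eq D with hD | hD <;> omega
  · obtain ⟨k, rfl⟩ := h4
    have hk4 : (4 * k : ℤ) / 4 = k := by omega
    rw [hk4] at hsq h23
    have hk0 : k ≠ 0 := hsq.ne_zero
    rcases Int.natAbs_eq (4 * k) with hD | hD <;> omega

/-- **`χ_D ≠ 1` for every fundamental discriminant `D`**: its conductor is `|D| ≥ 3`, not `1`
(`isPrimitive_kroneckerChar`, Mathlib `eq_one_iff_conductor_eq_one`). [cite: MontgomeryVaughan2007, §9.3] -/
theorem kroneckerChar_ne_one {D : ℤ} (hD : IsFundamentalDiscriminant D) [NeZero D.natAbs] :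
    kroneckerChar D ≠ 1 := by
  intro h1
  have hc : (kroneckerChar D).conductor = D.natAbs := isPrimitive_kroneckerChar hD
  rw [(DirichletCharacter.eq_one_iff_conductor_eq_one (χ := kroneckerChar D)).mp h1] at hc
  have := three_le_natAbs_of_isFundamentalDiscriminant hD
  omega

/-- **`L(1, χ_D)` is real and positive for every fundamental discriminant** (no witness needed).
[cite: MontgomeryVaughan2007, §9.3] -/
theorem LFunction_one_pos {D : ℤ} (hD : IsFundamentalDiscriminant D) [NeZero D.natAbs] :
    0 < ((kroneckerChar D).LFunction 1).re ∧ ((kroneckerChar D).LFunction 1).im = 0 :=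
  LFunction_one_pos_of_ne_one (kroneckerChar_ne_one hD)

end Literature.NumberTheory.LFunctions.KroneckerCharacter

end
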